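import Mathlib.Analysis.Calculus.MeanValue
import Mathlib.Analysis.Calculus.FDeriv.CompCLM
import Mathlib.Analysis.SpecialFunctions.Pow.Deriv
import Literature.NumberTheory.Rogawski1990.Ch9Sec3
import HarnessLib

/-!
# [Rogawski1990, §9.3] — PROOF of LEMMA 9.3.3 (the calculus lemma on `ℝ^m`): `lemma933_holds : Lemma933`,
# the discharge of the one closed named fact of the carpet ★ `Ch9Sec3`

J. D. Rogawski, *Automorphic Representations of Unitary Groups in Three Variables*, Ann. of Math. Stud. 123 (1990) [Rogawski1990],
§9.3 LEMMA 9.3.3 p. 144 and its proof pp. 144–145 (held text `book:rogawski1990-automorphic-representation-unitary-groups-three-variables`,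
chunks p0139 L27 – p0140 L5, materialised).  Squad TR (cell hodgecm-mathlib), seat TR-t05 (g3); companion of ★
`Literature/NumberTheory/Rogawski1990/Ch9Sec3.lean` (namespace `Literature.NumberTheory.Rogawski1990.Ch9Sec3`), whose §1 states LEMMA 9.3.3
CONCRETELY over `EuclideanSpace ℝ (Fin m)` as the hypothesis-free named fact `Lemma933` («`X` ranges over the iterated directional
derivatives `iteratedFDerivWithin ℝ k φ B′(t) ξ v`»).  THEOREMS ONLY (kernel lane): no new `Prop` definition, no named fact, no `sorry`,
no `instance`, no notation; the statement proved is ★ `Ch9Sec3.Lemma933` BY NAME (unchanged).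

THE STATEMENT.  `λ₁, …, λ_n` continuous linear forms on `ℝ^m`, `B′(t) = {‖ξ‖ ≤ t, λ_j(ξ) ≠ 0 ∀ j}` (★ `puncturedBall`), `φ` smooth on `B′(t)`,
and for some `r : ℕ` every derivative `D^k φ(ξ)(v)` (within `B′(t)`) is `< C(k, v) · |∏_j λ_j(ξ)|^{-r}` on `B′(t)`.  CLAIM: for some
`0 < t′ ≤ t` every `D^k φ(·)(v)` is bounded on `B′(t′)`.  We prove it with `t′ = t / 2^{nr+1}` (`t′ = t` when `n = 0`).

THE PRINTED PROOF (p. 144–145) and HOW IT IS FOLLOWED.  Print: «We may work within a connected component of `{λ_i ≠ 0}`» — here: a SIGN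
CHAMBER `{ξ : λ_j(ξ)λ_j(w) > 0 ∀ j}` of a unit vector `w` (finitely many, indexed by the sign patterns `Fin n → Bool`; the final constant is the
sum of the chamber constants, `lemma933_holds`).  Print: reduction to simplicial cones∕coordinates `|Xφ(x)| < C ∏|x_i|^{-m}` and the estimate
«`Xφ(x) = Xφ(ε,…,ε) + ∫…∫ (∂₁⋯∂_m)Xφ`» giving «`C ∏|x_i|^{-r+1}` if `r > 1`», «and the lemma follows by induction on `r`».  DEVIATION (one, recorded):
instead of triangulating the chamber into simplicial cones we move along ONE interior direction of the chamber — the unit vector `w` itself: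
along `s ↦ ξ + s·w` every `|λ_j|` grows linearly, `|λ_j(ξ + s w)| = |λ_j(ξ)| + s|λ_j(w)| ≥ c + a s` whenever `c ≤ |λ_j(ξ)|` and `a ≤ |λ_j(w)|` for
all `j` (`abs_add_mul_of_pos_mul`), and the product bound is weakened once to the gauge bound `|∏ λ_j(ξ)|^{-r} ≤ c^{-nr}` (`base_case`, which also
trades `nr` for the half-integer exponent `nr + ½` using `c ≤ ‖λ_{j₀}‖ t + 1`).  The print's one-dimensional integration is then the FENCING
form of the mean value theorem (Mathlib `image_norm_le_of_norm_deriv_right_le_deriv_boundary'`, no integral needed): for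
`F(s) = D^k φ(ξ + (s₀ - s) w)(v)`, `s ∈ [0, s₀]`, `s₀ = τ/4`, one has `F′(s) = -D^{k+1} φ(ξ + (s₀ - s) w)(w, v)` (`iteratedFDerivWithin_succ_apply_left`
at interior points of `B′(t)`, where `B′(t)` is a neighbourhood — `puncturedBall_mem_nhds`; differentiability of `D^k φ` within `B′(t)` from
`ContDiffOn.differentiableOn_iteratedFDerivWithin` and `uniqueDiffOn_puncturedBall` = closed ball ∩ open set), `‖F′(s)‖ ≤ C₁ (c + a(s₀ - s))^{-p}`,
and the barrier `B(s) = C₀ (a s₀)^{-p} + C₁∕(a(p-1)) · ((c + a(s₀ - s))^{1-p} - (c + a s₀)^{1-p})` has `B′ = C₁ (c + a(s₀ - s))^{-p}` and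
`B(0) ≥ ‖F(0)‖` (the far point `ξ + s₀ w` has gauge `≥ a s₀`): this is `step_core`, giving `‖D^k φ(ξ)(v)‖ ≤ B(s₀)` for `‖ξ‖ ≤ τ/2`
(the path stays in the ball of radius `3τ/4 < τ ≤ t`).  The print's «induction on `r`» is `descent`: `step_down` lowers the exponent `p > 1` to
`p - 1` while halving the radius (orders `k` and `k + 1` at radius `τ` feed order `k` at radius `τ/2`), from `nr + ½` down to `½` in `nr` steps,
and `step_final` (`p = ½ < 1`, where `B(s₀)` is bounded outright) gives boundedness at radius `t / 2^{nr+1}` in each chamber.  The half-integer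
exponents avoid the print's separate logarithmic case «`r = 1`».  Case `n = 0` (no hyperplane): the hypothesis is already the bound.

HONEST LABEL: HC_CM is proved only modulo the 7 printed citations (2 remaining: hLiu418 = stmt-HodgeConjecture-24832, h413 = stmt-HodgeConjecture-24833)
until rung 0 closes; this file adds no citation debt (0 facts, 0 sorry) and discharges one named fact of ★ `Ch9Sec3` (`Lemma933`; net debt −1).
-/

noncomputable section

namespace Literature.NumberTheory.Rogawski1990.Ch9Sec3

open Set Filter Real
open _root_.Topology

variable {m n : ℕ}

/-! ## §1 The set `B′(t)`: neighbourhoods and unique differentiability -/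

/-- A point of `B′(t)` of norm `< t` is an interior point of `B′(t)`. [folklore] -/
private theorem puncturedBall_mem_nhds (lam : Fin n → EuclideanSpace ℝ (Fin m) →L[ℝ] ℝ) (t : ℝ)
    {x : EuclideanSpace ℝ (Fin m)} (hxt : ‖x‖ < t) (hx : ∀ j, lam j x ≠ 0) :
    puncturedBall lam t ∈ 𝓝 x := by
  have h1 : ∀ᶠ y in 𝓝 x, ‖y‖ < t :=
    (isOpen_lt continuous_norm continuous_const).mem_nhds hxt
  have h2 : ∀ᶠ y in 𝓝 x, ∀ j, lam j y ≠ 0 :=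
    eventually_all.2 fun j => (lam j).continuous.continuousAt.eventually_ne (hx j)
  filter_upwards [h1, h2] with y hy1 hy2
  exact ⟨hy1.le, hy2⟩

/-- `B′(t)` (a closed ball with finitely many hyperplanes removed) has the unique differentiability property. [folklore] -/
private theorem uniqueDiffOn_puncturedBall (lam : Fin n → EuclideanSpace ℝ (Fin m) →L[ℝ] ℝ) {t : ℝ}
    (ht : 0 < t) : UniqueDiffOn ℝ (puncturedBall lam t) := by
  have hS : puncturedBall lam t =
      Metric.closedBall (0 : EuclideanSpace ℝ (Fin m)) t ∩ {x | ∀ j, lam j x ≠ 0} := by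
    ext x
    simp [puncturedBall, Metric.mem_closedBall, dist_zero_right]
  intro x hx
  have hU : {y : EuclideanSpace ℝ (Fin m) | ∀ j, lam j y ≠ 0} ∈ 𝓝 x :=
    eventually_all.2 fun j => (lam j).continuous.continuousAt.eventually_ne (hx.2 j)
  have hB : UniqueDiffWithinAt ℝ (Metric.closedBall (0 : EuclideanSpace ℝ (Fin m)) t) x :=
    uniqueDiffOn_convex (convex_closedBall _ _)
      ⟨0, mem_interior_iff_mem_nhds.2 (Metric.closedBall_mem_nhds _ ht)⟩ x
      (by simpa [Metric.mem_closedBall, dist_zero_right] using hx.1)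
  rw [hS]
  exact hB.inter hU

/-! ## §2 The flow `s ↦ ξ + s·w` inside a sign chamber -/

/-- Same-sign additivity of absolute values along the flow: `|α + uβ| = |α| + u|β|` if `αβ > 0`, `u ≥ 0`. [folklore] -/
private theorem abs_add_mul_of_pos_mul {α β u : ℝ} (h : 0 < α * β) (hu : 0 ≤ u) :
    |α + u * β| = |α| + u * |β| := by
  rcases pos_and_pos_or_neg_and_neg_of_mul_pos h with ⟨hα, hβ⟩ | ⟨hα, hβ⟩
  · have : 0 ≤ α + u * β := by nlinarith
    rw [abs_of_nonneg this, abs_of_pos hα, abs_of_pos hβ]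
  · have : α + u * β ≤ 0 := by nlinarith
    rw [abs_of_nonpos this, abs_of_neg hα, abs_of_neg hβ]; ring

/-- Existence of a positive lower bound for finitely many non-zero absolute values. [folklore] -/
private theorem exists_pos_le_abs (lam : Fin n → EuclideanSpace ℝ (Fin m) →L[ℝ] ℝ)
    (x : EuclideanSpace ℝ (Fin m)) (hx : ∀ j, lam j x ≠ 0) :
    ∃ c : ℝ, 0 < c ∧ ∀ j, c ≤ |lam j x| := by
  rcases isEmpty_or_nonempty (Fin n) with hn | hn
  · exact ⟨1, one_pos, fun j => (IsEmpty.false j).elim⟩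
  · obtain ⟨j₀, -, hj₀⟩ :=
      Finset.exists_min_image Finset.univ (fun j => |lam j x|) Finset.univ_nonempty
    exact ⟨|lam j₀ x|, abs_pos.2 (hx j₀), fun j => hj₀ j (Finset.mem_univ j)⟩

/-! ## §3 The STEP: the fencing (barrier) form of the mean value theorem along the flow -/

/-- **Core estimate.**  In the chamber of `w` (`λ_j(ξ)λ_j(w) > 0`), if the `k`-th and `(k+1)`-st derivatives of `φ` within `B′(t)` are
bounded by `C₀ c^{-p}`, `C₁ c^{-p}` on the ball of radius `τ` whenever `0 < c ≤ |λ_j(ξ)|` for all `j`, then on the ball of radius `τ/2`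
the `k`-th derivative is bounded by the value at `s₀ = τ/4` of the barrier
`B(s) = C₀ (a s₀)^{-p} + C₁/(a(p-1)) · ((c + a(s₀ - s))^{1-p} - (c + a s₀)^{1-p})`, obtained by moving from `ξ + s₀ w` back to `ξ`
(the print's «`Xφ(x) = Xφ(ε,…,ε) + ∫ … (∂)Xφ`», one direction, fencing form).
[cite: Rogawski1990, §9.3 proof of Lemma 9.3.3 (pp. 144–145, chunks p0139–p0140)] -/
private theorem step_core (lam : Fin n → EuclideanSpace ℝ (Fin m) →L[ℝ] ℝ) (t : ℝ)
    (φ : EuclideanSpace ℝ (Fin m) → ℂ) (ht : 0 < t)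
    (hφ : ContDiffOn ℝ ((⊤ : ℕ∞) : WithTop ℕ∞) φ (puncturedBall lam t))
    (w : EuclideanSpace ℝ (Fin m)) (hw1 : ‖w‖ = 1) (a : ℝ) (ha : 0 < a) (haw : ∀ j, a ≤ |lam j w|)
    (p τ : ℝ) (hp1 : p ≠ 1) (hτ : 0 < τ) (hτt : τ ≤ t)
    (k : ℕ) (v : Fin k → EuclideanSpace ℝ (Fin m)) (C₀ C₁ : ℝ)
    (h₀ : ∀ ξ : EuclideanSpace ℝ (Fin m), ‖ξ‖ ≤ τ → (∀ j, 0 < lam j ξ * lam j w) →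
      ∀ c : ℝ, 0 < c → (∀ j, c ≤ |lam j ξ|) →
        ‖iteratedFDerivWithin ℝ k φ (puncturedBall lam t) ξ v‖ ≤ C₀ * c ^ (-p))
    (h₁ : ∀ ξ : EuclideanSpace ℝ (Fin m), ‖ξ‖ ≤ τ → (∀ j, 0 < lam j ξ * lam j w) →
      ∀ c : ℝ, 0 < c → (∀ j, c ≤ |lam j ξ|) →
        ‖iteratedFDerivWithin ℝ (k + 1) φ (puncturedBall lam t) ξ (Fin.cons w v)‖ ≤ C₁ * c ^ (-p))
    (ξ : EuclideanSpace ℝ (Fin m)) (hξ : ‖ξ‖ ≤ τ / 2) (hξw : ∀ j, 0 < lam j ξ * lam j w)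
    (c : ℝ) (hc : 0 < c) (hcξ : ∀ j, c ≤ |lam j ξ|) :
    ‖iteratedFDerivWithin ℝ k φ (puncturedBall lam t) ξ v‖ ≤
      C₀ * (a * (τ / 4)) ^ (-p) +
        C₁ / (a * (p - 1)) * (c ^ (1 - p) - (c + a * (τ / 4)) ^ (1 - p)) := by
  have hs₀pos : 0 < τ / 4 := by positivity
  -- the path and its properties
  have hγnorm : ∀ s ∈ Icc (0:ℝ) (τ / 4), ‖ξ + (τ / 4 - s) • w‖ < τ := by
    intro s hs
    calc ‖ξ + (τ / 4 - s) • w‖ ≤ ‖ξ‖ + ‖(τ / 4 - s) • w‖ := norm_add_le _ _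
      _ = ‖ξ‖ + (τ / 4 - s) := by
          rw [norm_smul, hw1, mul_one, Real.norm_eq_abs, abs_of_nonneg (by linarith [hs.2])]
      _ < τ := by linarith [hs.1]
  have hlamγ : ∀ s j, lam j (ξ + (τ / 4 - s) • w) = lam j ξ + (τ / 4 - s) * lam j w := by
    intro s j
    simp only [map_add, map_smul, smul_eq_mul]
  have hγabs : ∀ s ∈ Icc (0:ℝ) (τ / 4), ∀ j, c + a * (τ / 4 - s) ≤ |lam j (ξ + (τ / 4 - s) • w)| := by
    intro s hs j
    rw [hlamγ, abs_add_mul_of_pos_mul (hξw j) (by linarith [hs.2])]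
    have := haw j; have := hcξ j
    nlinarith [hs.2]
  have hγcham : ∀ s ∈ Icc (0:ℝ) (τ / 4), ∀ j, 0 < lam j (ξ + (τ / 4 - s) • w) * lam j w := by
    intro s hs j
    rw [hlamγ, add_mul]
    have : 0 ≤ (τ / 4 - s) * lam j w * lam j w := by
      have := mul_self_nonneg (lam j w); nlinarith [hs.2]
    linarith [hξw j]
  have hγS : ∀ s ∈ Icc (0:ℝ) (τ / 4), ξ + (τ / 4 - s) • w ∈ puncturedBall lam t := fun s hs =>
    ⟨(hγnorm s hs).le.trans hτt, fun j h0 => by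
      have := hγabs s hs j; rw [h0, abs_zero] at this; nlinarith [hs.2]⟩
  have hγnhds : ∀ s ∈ Icc (0:ℝ) (τ / 4), puncturedBall lam t ∈ 𝓝 (ξ + (τ / 4 - s) • w) := fun s hs =>
    puncturedBall_mem_nhds lam t ((hγnorm s hs).trans_le hτt) (hγS s hs).2
  -- differentiability of the `k`-th derivative at the points of the path
  have hSU : UniqueDiffOn ℝ (puncturedBall lam t) := uniqueDiffOn_puncturedBall lam ht
  have hGdiff : DifferentiableOn ℝ (iteratedFDerivWithin ℝ k φ (puncturedBall lam t)) (puncturedBall lam t) :=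
    hφ.differentiableOn_iteratedFDerivWithin (by exact_mod_cast ENat.coe_lt_top k) hSU
  have hGat : ∀ s ∈ Icc (0:ℝ) (τ / 4),
      HasFDerivAt (iteratedFDerivWithin ℝ k φ (puncturedBall lam t))
        (fderivWithin ℝ (iteratedFDerivWithin ℝ k φ (puncturedBall lam t)) (puncturedBall lam t)
          (ξ + (τ / 4 - s) • w)) (ξ + (τ / 4 - s) • w) := by
    intro s hs
    rw [fderivWithin_of_mem_nhds (hγnhds s hs)]
    exact ((hGdiff _ (hγS s hs)).differentiableAt (hγnhds s hs)).hasFDerivAt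
  -- the one-variable function `F` and its derivative `F'`
  have hγderiv : ∀ s : ℝ, HasDerivAt (fun x : ℝ => ξ + (τ / 4 - x) • w) (-w) s := by
    intro s
    have := (((hasDerivAt_id s).const_sub (τ / 4)).smul_const w).const_add ξ
    simpa using this
  have hFderiv : ∀ s ∈ Icc (0:ℝ) (τ / 4),
      HasDerivAt (fun x : ℝ => iteratedFDerivWithin ℝ k φ (puncturedBall lam t) (ξ + (τ / 4 - x) • w) v)
        (-((fderivWithin ℝ (iteratedFDerivWithin ℝ k φ (puncturedBall lam t)) (puncturedBall lam t)
          (ξ + (τ / 4 - s) • w) w) v)) s := by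
    intro s hs
    have h1 := (hGat s hs).comp_hasDerivAt s (hγderiv s)
    have h2 := (ContinuousMultilinearMap.apply ℝ (fun _ : Fin k => EuclideanSpace ℝ (Fin m)) ℂ v).hasFDerivAt.comp_hasDerivAt s h1
    simpa [Function.comp_def] using h2
  -- `‖F'‖` is the norm of a `(k+1)`-st derivative of `φ`
  have hF'eq : ∀ s : ℝ,
      ‖-((fderivWithin ℝ (iteratedFDerivWithin ℝ k φ (puncturedBall lam t)) (puncturedBall lam t)
          (ξ + (τ / 4 - s) • w) w) v)‖ =
        ‖iteratedFDerivWithin ℝ (k + 1) φ (puncturedBall lam t) (ξ + (τ / 4 - s) • w) (Fin.cons w v)‖ := by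
    intro s
    rw [norm_neg, iteratedFDerivWithin_succ_apply_left]
    simp only [Fin.cons_zero, Fin.tail_cons]
  -- the barrier `B` and its derivative `B'`
  have hbase : ∀ s ∈ Icc (0:ℝ) (τ / 4), 0 < c + a * (τ / 4 - s) := fun s hs => by nlinarith [hs.2]
  have hBderiv : ∀ s ∈ Icc (0:ℝ) (τ / 4),
      HasDerivAt (fun x : ℝ => C₀ * (a * (τ / 4)) ^ (-p) +
          C₁ / (a * (p - 1)) * ((c + a * (τ / 4 - x)) ^ (1 - p) - (c + a * (τ / 4)) ^ (1 - p)))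
        (C₁ * (c + a * (τ / 4 - s)) ^ (-p)) s := by
    intro s hs
    have hne : c + a * (τ / 4 - s) ≠ 0 := (hbase s hs).ne'
    have h1 : HasDerivAt (fun x : ℝ => c + a * (τ / 4 - x)) (a * -1) s := by
      simpa using (((hasDerivAt_id s).const_sub (τ / 4)).const_mul a).const_add c
    have h2 := (((h1.rpow_const (p := 1 - p) (Or.inl hne)).sub_const ((c + a * (τ / 4)) ^ (1 - p))).const_mul
      (C₁ / (a * (p - 1)))).const_add (C₀ * (a * (τ / 4)) ^ (-p))
    have h3 : C₁ / (a * (p - 1)) * (a * -1 * (1 - p) * (c + a * (τ / 4 - s)) ^ (1 - p - 1)) =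
        C₁ * (c + a * (τ / 4 - s)) ^ (-p) := by
      rw [show (1:ℝ) - p - 1 = -p by ring]
      have hp1' : p - 1 ≠ 0 := sub_ne_zero.2 hp1
      field_simp
      ring
    rw [← h3]
    exact h2
  -- the fencing theorem
  have hFcont : ContinuousOn
      (fun x : ℝ => iteratedFDerivWithin ℝ k φ (puncturedBall lam t) (ξ + (τ / 4 - x) • w) v) (Icc 0 (τ / 4)) :=
    fun s hs => (hFderiv s hs).continuousAt.continuousWithinAt
  have hBcont : ContinuousOn (fun x : ℝ => C₀ * (a * (τ / 4)) ^ (-p) +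
      C₁ / (a * (p - 1)) * ((c + a * (τ / 4 - x)) ^ (1 - p) - (c + a * (τ / 4)) ^ (1 - p))) (Icc 0 (τ / 4)) :=
    fun s hs => (hBderiv s hs).continuousAt.continuousWithinAt
  have hinit : ‖iteratedFDerivWithin ℝ k φ (puncturedBall lam t) (ξ + (τ / 4 - 0) • w) v‖ ≤
      C₀ * (a * (τ / 4)) ^ (-p) +
        C₁ / (a * (p - 1)) * ((c + a * (τ / 4 - 0)) ^ (1 - p) - (c + a * (τ / 4)) ^ (1 - p)) := by
    have h0mem : (0:ℝ) ∈ Icc (0:ℝ) (τ / 4) := left_mem_Icc.2 hs₀pos.le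
    have := h₀ _ (hγnorm 0 h0mem).le (hγcham 0 h0mem) (a * (τ / 4)) (by positivity)
      (fun j => by have := hγabs 0 h0mem j; linarith)
    simpa using this
  have hbound : ∀ s ∈ Ico (0:ℝ) (τ / 4),
      ‖-((fderivWithin ℝ (iteratedFDerivWithin ℝ k φ (puncturedBall lam t)) (puncturedBall lam t)
          (ξ + (τ / 4 - s) • w) w) v)‖ ≤ C₁ * (c + a * (τ / 4 - s)) ^ (-p) := by
    intro s hs
    have hs' : s ∈ Icc (0:ℝ) (τ / 4) := Ico_subset_Icc_self hs
    rw [hF'eq]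
    exact h₁ _ (hγnorm s hs').le (hγcham s hs') _ (hbase s hs') (hγabs s hs')
  have key := image_norm_le_of_norm_deriv_right_le_deriv_boundary' hFcont
    (fun s hs => (hFderiv s (Ico_subset_Icc_self hs)).hasDerivWithinAt) hinit hBcont
    (fun s hs => (hBderiv s (Ico_subset_Icc_self hs)).hasDerivWithinAt) hbound
    (right_mem_Icc.2 hs₀pos.le)
  simpa using key

/-! ## §4 The descent on the exponent (induction on `r` in the print) -/

/-- **STEP for `p > 1`**: exponent `p ↦ p - 1`, radius `τ ↦ τ/2` (all orders `k` at once, the order `k + 1` feeding the order `k`);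
the print's «`< C ∏|x_i|^{-r+1}` if `r > 1`». [cite: Rogawski1990, §9.3 proof of Lemma 9.3.3 (p. 145, chunk p0140)] -/
private theorem step_down (lam : Fin n → EuclideanSpace ℝ (Fin m) →L[ℝ] ℝ) (t : ℝ)
    (φ : EuclideanSpace ℝ (Fin m) → ℂ) (ht : 0 < t)
    (hφ : ContDiffOn ℝ ((⊤ : ℕ∞) : WithTop ℕ∞) φ (puncturedBall lam t)) (j₀ : Fin n)
    (w : EuclideanSpace ℝ (Fin m)) (hw1 : ‖w‖ = 1) (a : ℝ) (ha : 0 < a) (haw : ∀ j, a ≤ |lam j w|)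
    (p τ : ℝ) (hp : 1 < p) (hτ : 0 < τ) (hτt : τ ≤ t)
    (hp_all : ∀ (k : ℕ) (v : Fin k → EuclideanSpace ℝ (Fin m)), ∃ C : ℝ, ∀ ξ : EuclideanSpace ℝ (Fin m),
      ‖ξ‖ ≤ τ → (∀ j, 0 < lam j ξ * lam j w) → ∀ c : ℝ, 0 < c → (∀ j, c ≤ |lam j ξ|) →
        ‖iteratedFDerivWithin ℝ k φ (puncturedBall lam t) ξ v‖ ≤ C * c ^ (-p)) :
    ∀ (k : ℕ) (v : Fin k → EuclideanSpace ℝ (Fin m)), ∃ C : ℝ, ∀ ξ : EuclideanSpace ℝ (Fin m),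
      ‖ξ‖ ≤ τ / 2 → (∀ j, 0 < lam j ξ * lam j w) → ∀ c : ℝ, 0 < c → (∀ j, c ≤ |lam j ξ|) →
        ‖iteratedFDerivWithin ℝ k φ (puncturedBall lam t) ξ v‖ ≤ C * c ^ (-(p - 1)) := by
  intro k v
  obtain ⟨C₀, h₀⟩ := hp_all k v
  obtain ⟨C₁, h₁⟩ := hp_all (k + 1) (Fin.cons w v)
  have hKpos : 0 < ‖lam j₀‖ * t + 1 := by positivity
  refine ⟨C₀ * (a * (τ / 4)) ^ (-p) * (‖lam j₀‖ * t + 1) ^ (p - 1) + C₁ / (a * (p - 1)),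
    fun ξ hξ hξw c hc hcξ => ?_⟩
  have hcore := step_core lam t φ ht hφ w hw1 a ha haw p τ hp.ne' hτ hτt k v C₀ C₁ h₀ h₁ ξ hξ hξw c hc hcξ
  have hcK : c ≤ ‖lam j₀‖ * t + 1 := by
    calc c ≤ |lam j₀ ξ| := hcξ j₀
      _ = ‖lam j₀ ξ‖ := (Real.norm_eq_abs _).symm
      _ ≤ ‖lam j₀‖ * ‖ξ‖ := (lam j₀).le_opNorm ξ
      _ ≤ ‖lam j₀‖ * t := by gcongr; linarith
      _ ≤ ‖lam j₀‖ * t + 1 := by linarith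
  have hC₀ : 0 ≤ C₀ := by
    have h := (norm_nonneg _).trans (h₀ ξ (by linarith) hξw c hc hcξ)
    exact le_of_mul_le_mul_right (by rwa [zero_mul]) (rpow_pos_of_pos hc _)
  have hC₁ : 0 ≤ C₁ := by
    have h := (norm_nonneg _).trans (h₁ ξ (by linarith) hξw c hc hcξ)
    exact le_of_mul_le_mul_right (by rwa [zero_mul]) (rpow_pos_of_pos hc _)
  have hA : 0 ≤ C₀ * (a * (τ / 4)) ^ (-p) := mul_nonneg hC₀ (rpow_nonneg (by positivity) _)
  have hcoef : 0 ≤ C₁ / (a * (p - 1)) := div_nonneg hC₁ (by nlinarith)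
  have hone : 1 ≤ (‖lam j₀‖ * t + 1) ^ (p - 1) * c ^ (1 - p) := by
    have h1 : (‖lam j₀‖ * t + 1) ^ (1 - p) ≤ c ^ (1 - p) := rpow_le_rpow_of_nonpos hc hcK (by linarith)
    have h2 : (‖lam j₀‖ * t + 1) ^ (p - 1) * (‖lam j₀‖ * t + 1) ^ (1 - p) = 1 := by
      rw [← rpow_add hKpos, show p - 1 + (1 - p) = 0 by ring, rpow_zero]
    calc (1:ℝ) = (‖lam j₀‖ * t + 1) ^ (p - 1) * (‖lam j₀‖ * t + 1) ^ (1 - p) := h2.symm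
      _ ≤ (‖lam j₀‖ * t + 1) ^ (p - 1) * c ^ (1 - p) :=
          mul_le_mul_of_nonneg_left h1 (rpow_nonneg hKpos.le _)
  have hpos2 : 0 ≤ (c + a * (τ / 4)) ^ (1 - p) := rpow_nonneg (by positivity) _
  have hmul := mul_le_mul_of_nonneg_left hone hA
  have hmul2 := mul_nonneg hcoef hpos2
  rw [neg_sub]
  calc ‖iteratedFDerivWithin ℝ k φ (puncturedBall lam t) ξ v‖
        ≤ C₀ * (a * (τ / 4)) ^ (-p) + C₁ / (a * (p - 1)) * (c ^ (1 - p) - (c + a * (τ / 4)) ^ (1 - p)) := hcore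
    _ ≤ C₀ * (a * (τ / 4)) ^ (-p) * ((‖lam j₀‖ * t + 1) ^ (p - 1) * c ^ (1 - p)) +
          C₁ / (a * (p - 1)) * c ^ (1 - p) := by linarith
    _ = (C₀ * (a * (τ / 4)) ^ (-p) * (‖lam j₀‖ * t + 1) ^ (p - 1) + C₁ / (a * (p - 1))) * c ^ (1 - p) := by
          ring

/-- **FINAL STEP** (`p = 1/2 < 1`): boundedness at radius `τ/2` in the chamber of `w` (the last round of the print's induction).
[cite: Rogawski1990, §9.3 proof of Lemma 9.3.3 (p. 145, chunk p0140)] -/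
private theorem step_final (lam : Fin n → EuclideanSpace ℝ (Fin m) →L[ℝ] ℝ) (t : ℝ)
    (φ : EuclideanSpace ℝ (Fin m) → ℂ) (ht : 0 < t)
    (hφ : ContDiffOn ℝ ((⊤ : ℕ∞) : WithTop ℕ∞) φ (puncturedBall lam t)) (j₀ : Fin n)
    (w : EuclideanSpace ℝ (Fin m)) (hw1 : ‖w‖ = 1) (a : ℝ) (ha : 0 < a) (haw : ∀ j, a ≤ |lam j w|)
    (τ : ℝ) (hτ : 0 < τ) (hτt : τ ≤ t)
    (hp_all : ∀ (k : ℕ) (v : Fin k → EuclideanSpace ℝ (Fin m)), ∃ C : ℝ, ∀ ξ : EuclideanSpace ℝ (Fin m),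
      ‖ξ‖ ≤ τ → (∀ j, 0 < lam j ξ * lam j w) → ∀ c : ℝ, 0 < c → (∀ j, c ≤ |lam j ξ|) →
        ‖iteratedFDerivWithin ℝ k φ (puncturedBall lam t) ξ v‖ ≤ C * c ^ (-(1 / 2 : ℝ))) :
    ∀ (k : ℕ) (v : Fin k → EuclideanSpace ℝ (Fin m)), ∃ C : ℝ, ∀ ξ : EuclideanSpace ℝ (Fin m),
      ‖ξ‖ ≤ τ / 2 → (∀ j, 0 < lam j ξ * lam j w) →
        ‖iteratedFDerivWithin ℝ k φ (puncturedBall lam t) ξ v‖ ≤ C := by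
  intro k v
  obtain ⟨C₀, h₀⟩ := hp_all k v
  obtain ⟨C₁, h₁⟩ := hp_all (k + 1) (Fin.cons w v)
  have hKpos : 0 < ‖lam j₀‖ * t + 1 := by positivity
  refine ⟨C₀ * (a * (τ / 4)) ^ (-(1 / 2 : ℝ)) +
      C₁ / (a * (1 / 2)) * (‖lam j₀‖ * t + 1 + a * (τ / 4)) ^ (1 / 2 : ℝ), fun ξ hξ hξw => ?_⟩
  have hξS : ∀ j, lam j ξ ≠ 0 := fun j h0 => by
    have := hξw j; rw [h0, zero_mul] at this; exact lt_irrefl _ this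
  obtain ⟨c, hc, hcξ⟩ := exists_pos_le_abs lam ξ hξS
  have hcore := step_core lam t φ ht hφ w hw1 a ha haw (1 / 2) τ (by norm_num) hτ hτt k v C₀ C₁ h₀ h₁
    ξ hξ hξw c hc hcξ
  have hcK : c ≤ ‖lam j₀‖ * t + 1 := by
    calc c ≤ |lam j₀ ξ| := hcξ j₀
      _ = ‖lam j₀ ξ‖ := (Real.norm_eq_abs _).symm
      _ ≤ ‖lam j₀‖ * ‖ξ‖ := (lam j₀).le_opNorm ξ
      _ ≤ ‖lam j₀‖ * t := by gcongr; linarith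
      _ ≤ ‖lam j₀‖ * t + 1 := by linarith
  have hC₁ : 0 ≤ C₁ := by
    have h := (norm_nonneg _).trans (h₁ ξ (by linarith) hξw c hc hcξ)
    exact le_of_mul_le_mul_right (by rwa [zero_mul]) (rpow_pos_of_pos hc _)
  have h1 : (1 : ℝ) - 1 / 2 = 1 / 2 := by norm_num
  rw [h1] at hcore
  have hmono : (c + a * (τ / 4)) ^ (1 / 2 : ℝ) ≤ (‖lam j₀‖ * t + 1 + a * (τ / 4)) ^ (1 / 2 : ℝ) :=
    rpow_le_rpow (by positivity) (by linarith) (by norm_num)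
  have hcnn : 0 ≤ c ^ (1 / 2 : ℝ) := rpow_nonneg hc.le _
  have hcoef : 0 ≤ C₁ / (a * (1 / 2)) := by positivity
  have hm1 := mul_le_mul_of_nonneg_left hmono hcoef
  have hm2 := mul_nonneg hcoef hcnn
  calc ‖iteratedFDerivWithin ℝ k φ (puncturedBall lam t) ξ v‖
        ≤ C₀ * (a * (τ / 4)) ^ (-(1 / 2 : ℝ)) +
            C₁ / (a * (1 / 2 - 1)) * (c ^ (1 / 2 : ℝ) - (c + a * (τ / 4)) ^ (1 / 2 : ℝ)) := hcore
    _ = C₀ * (a * (τ / 4)) ^ (-(1 / 2 : ℝ)) +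
            C₁ / (a * (1 / 2)) * ((c + a * (τ / 4)) ^ (1 / 2 : ℝ) - c ^ (1 / 2 : ℝ)) := by ring
    _ ≤ C₀ * (a * (τ / 4)) ^ (-(1 / 2 : ℝ)) +
            C₁ / (a * (1 / 2)) * (‖lam j₀‖ * t + 1 + a * (τ / 4)) ^ (1 / 2 : ℝ) := by linarith

/-- **The descent** («the lemma follows by induction on `r`»): from exponent `N + 1/2` at radius `t` to exponent `N + 1/2 - i` at radius
`t / 2^i`, `i ≤ N`. [cite: Rogawski1990, §9.3 proof of Lemma 9.3.3 (p. 145, chunk p0140)] -/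
private theorem descent (lam : Fin n → EuclideanSpace ℝ (Fin m) →L[ℝ] ℝ) (t : ℝ)
    (φ : EuclideanSpace ℝ (Fin m) → ℂ) (ht : 0 < t)
    (hφ : ContDiffOn ℝ ((⊤ : ℕ∞) : WithTop ℕ∞) φ (puncturedBall lam t)) (j₀ : Fin n)
    (w : EuclideanSpace ℝ (Fin m)) (hw1 : ‖w‖ = 1) (a : ℝ) (ha : 0 < a) (haw : ∀ j, a ≤ |lam j w|) (N : ℕ)
    (hbase : ∀ (k : ℕ) (v : Fin k → EuclideanSpace ℝ (Fin m)), ∃ C : ℝ, ∀ ξ : EuclideanSpace ℝ (Fin m),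
      ‖ξ‖ ≤ t → (∀ j, 0 < lam j ξ * lam j w) → ∀ c : ℝ, 0 < c → (∀ j, c ≤ |lam j ξ|) →
        ‖iteratedFDerivWithin ℝ k φ (puncturedBall lam t) ξ v‖ ≤ C * c ^ (-((N : ℝ) + 1 / 2))) :
    ∀ i : ℕ, i ≤ N → ∀ (k : ℕ) (v : Fin k → EuclideanSpace ℝ (Fin m)), ∃ C : ℝ, ∀ ξ : EuclideanSpace ℝ (Fin m),
      ‖ξ‖ ≤ t / 2 ^ i → (∀ j, 0 < lam j ξ * lam j w) → ∀ c : ℝ, 0 < c → (∀ j, c ≤ |lam j ξ|) →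
        ‖iteratedFDerivWithin ℝ k φ (puncturedBall lam t) ξ v‖ ≤ C * c ^ (-((N : ℝ) + 1 / 2 - i)) := by
  intro i
  induction i with
  | zero => intro _; simpa using hbase
  | succ i ih =>
    intro hi k v
    have hi' : i ≤ N := Nat.le_of_succ_le hi
    have hp : 1 < (N : ℝ) + 1 / 2 - i := by
      have : (i : ℝ) + 1 ≤ N := by exact_mod_cast hi
      linarith
    have hτ : 0 < t / 2 ^ i := by positivity
    have hτt : t / 2 ^ i ≤ t := div_le_self ht.le (one_le_pow₀ (by norm_num))
    obtain ⟨C, hC⟩ := step_down lam t φ ht hφ j₀ w hw1 a ha haw ((N : ℝ) + 1 / 2 - i) (t / 2 ^ i) hp hτ hτt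
      (ih hi') k v
    refine ⟨C, fun ξ hξ hξw c hc hcξ => ?_⟩
    have h1 : t / 2 ^ (i + 1) = t / 2 ^ i / 2 := by rw [pow_succ]; ring
    have h2 : (-((N : ℝ) + 1 / 2 - ((i + 1 : ℕ) : ℝ))) = -((N : ℝ) + 1 / 2 - i - 1) := by push_cast; ring
    rw [h2]
    exact hC ξ (by rw [← h1]; exact hξ) hξw c hc hcξ

/-- **BASE**: the hypothesis of LEMMA 9.3.3 gives the exponent `nr + 1/2` for the gauge `c ≤ min_j |λ_j(ξ)|`
(`|∏ λ_j(ξ)|^{-r} ≤ c^{-nr}` and `c ≤ ‖λ_{j₀}‖ t + 1`); replaces the print's reduction «it is enough to consider an inequality of the form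
`|Xφ(x)| < C(X) ∏|x_i|^{-m}`». [cite: Rogawski1990, §9.3 proof of Lemma 9.3.3 (p. 144, chunk p0139)] -/
private theorem base_case (lam : Fin n → EuclideanSpace ℝ (Fin m) →L[ℝ] ℝ) (t : ℝ)
    (φ : EuclideanSpace ℝ (Fin m) → ℂ) (ht : 0 < t) (j₀ : Fin n) (w : EuclideanSpace ℝ (Fin m)) (r : ℕ)
    (hr : ∀ (k : ℕ) (v : Fin k → EuclideanSpace ℝ (Fin m)), ∃ C : ℝ, ∀ ξ ∈ puncturedBall lam t,
      ‖iteratedFDerivWithin ℝ k φ (puncturedBall lam t) ξ v‖ < C * (|∏ j, lam j ξ|⁻¹) ^ r) :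
    ∀ (k : ℕ) (v : Fin k → EuclideanSpace ℝ (Fin m)), ∃ C : ℝ, ∀ ξ : EuclideanSpace ℝ (Fin m),
      ‖ξ‖ ≤ t → (∀ j, 0 < lam j ξ * lam j w) → ∀ c : ℝ, 0 < c → (∀ j, c ≤ |lam j ξ|) →
        ‖iteratedFDerivWithin ℝ k φ (puncturedBall lam t) ξ v‖ ≤ C * c ^ (-(((n * r : ℕ) : ℝ) + 1 / 2)) := by
  intro k v
  obtain ⟨C, hC⟩ := hr k v
  have hKpos : 0 < ‖lam j₀‖ * t + 1 := by positivity
  refine ⟨max C 0 * (‖lam j₀‖ * t + 1) ^ (1 / 2 : ℝ), fun ξ hξ hξw c hc hcξ => ?_⟩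
  have hξS : ξ ∈ puncturedBall lam t := ⟨hξ, fun j h0 => by
    have := hξw j; rw [h0, zero_mul] at this; exact lt_irrefl _ this⟩
  have h1 := hC ξ hξS
  have hcK : c ≤ ‖lam j₀‖ * t + 1 := by
    calc c ≤ |lam j₀ ξ| := hcξ j₀
      _ = ‖lam j₀ ξ‖ := (Real.norm_eq_abs _).symm
      _ ≤ ‖lam j₀‖ * ‖ξ‖ := (lam j₀).le_opNorm ξ
      _ ≤ ‖lam j₀‖ * t := by gcongr
      _ ≤ ‖lam j₀‖ * t + 1 := by linarith
  have hprod : c ^ n ≤ |∏ j, lam j ξ| := by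
    rw [Finset.abs_prod]
    calc c ^ n = ∏ _j : Fin n, c := by simp
      _ ≤ ∏ j, |lam j ξ| := Finset.prod_le_prod (fun _ _ => hc.le) (fun j _ => hcξ j)
  have hA : (|∏ j, lam j ξ|⁻¹) ^ r ≤ c ^ (-(((n * r : ℕ) : ℝ))) := by
    have hcn : 0 < c ^ n := pow_pos hc n
    calc (|∏ j, lam j ξ|⁻¹) ^ r ≤ ((c ^ n)⁻¹) ^ r :=
          pow_le_pow_left₀ (inv_nonneg.2 (abs_nonneg _)) (inv_anti₀ hcn hprod) r
      _ = c ^ (-(((n * r : ℕ) : ℝ))) := by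
          rw [rpow_neg hc.le, rpow_natCast, pow_mul, inv_pow]
  have hB : c ^ (-(((n * r : ℕ) : ℝ))) ≤
      (‖lam j₀‖ * t + 1) ^ (1 / 2 : ℝ) * c ^ (-(((n * r : ℕ) : ℝ) + 1 / 2)) := by
    have e : c ^ (-(((n * r : ℕ) : ℝ))) = c ^ (1 / 2 : ℝ) * c ^ (-(((n * r : ℕ) : ℝ) + 1 / 2)) := by
      rw [← rpow_add hc]; congr 1; ring
    rw [e]
    exact mul_le_mul_of_nonneg_right (rpow_le_rpow hc.le hcK (by norm_num)) (rpow_nonneg hc.le _)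
  have hAr : 0 ≤ (|∏ j, lam j ξ|⁻¹) ^ r := pow_nonneg (inv_nonneg.2 (abs_nonneg _)) r
  calc ‖iteratedFDerivWithin ℝ k φ (puncturedBall lam t) ξ v‖ ≤ C * (|∏ j, lam j ξ|⁻¹) ^ r := h1.le
    _ ≤ max C 0 * (|∏ j, lam j ξ|⁻¹) ^ r := mul_le_mul_of_nonneg_right (le_max_left _ _) hAr
    _ ≤ max C 0 * ((‖lam j₀‖ * t + 1) ^ (1 / 2 : ℝ) * c ^ (-(((n * r : ℕ) : ℝ) + 1 / 2))) :=
        mul_le_mul_of_nonneg_left (hA.trans hB) (le_max_right _ _)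
    _ = max C 0 * (‖lam j₀‖ * t + 1) ^ (1 / 2 : ℝ) * c ^ (-(((n * r : ℕ) : ℝ) + 1 / 2)) := by ring

/-! ## §5 LEMMA 9.3.3 -/

/-- **LEMMA 9.3.3 holds** (discharge of the named fact ★ `Ch9Sec3.Lemma933`): with `t' = t / 2^{nr+1}`.
[cite: Rogawski1990, §9.3 Lemma 9.3.3 p. 144, chunks p0139–p0140] -/
theorem lemma933_holds : Lemma933 := by
  intro m n lam t φ ht hφ hr
  obtain ⟨r, hr⟩ := hr
  rcases isEmpty_or_nonempty (Fin n) with hn | ⟨⟨j₀⟩⟩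
  · -- no hyperplane: the hypothesis is already a bound
    refine ⟨t, ht, le_rfl, fun k v => ?_⟩
    obtain ⟨C, hC⟩ := hr k v
    refine ⟨C, fun ξ hξ => ?_⟩
    have := hC ξ hξ
    simp only [Finset.univ_eq_empty, Finset.prod_empty, abs_one, inv_one, one_pow, mul_one] at this
    exact this.le
  -- `n ≥ 1`: chamber by chamber
  refine ⟨t / 2 ^ (n * r + 1), by positivity, div_le_self ht.le (one_le_pow₀ (by norm_num)), fun k v => ?_⟩
  have ht' : t / 2 ^ (n * r + 1) ≤ t := div_le_self ht.le (one_le_pow₀ (by norm_num))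
  have key : ∀ ε : Fin n → Bool, ∃ C : ℝ, 0 ≤ C ∧ ∀ ξ ∈ puncturedBall lam (t / 2 ^ (n * r + 1)),
      (fun j => decide (0 < lam j ξ)) = ε → ‖iteratedFDerivWithin ℝ k φ (puncturedBall lam t) ξ v‖ ≤ C := by
    intro ε
    by_cases hε : ∃ x₀ ∈ puncturedBall lam t, (fun j => decide (0 < lam j x₀)) = ε
    · obtain ⟨x₀, hx₀, hx₀ε⟩ := hε
      have hx₀ne : x₀ ≠ 0 := fun h => hx₀.2 j₀ (by rw [h, map_zero])
      have hx₀pos : 0 < ‖x₀‖ := norm_pos_iff.2 hx₀ne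
      have hw1 : ‖‖x₀‖⁻¹ • x₀‖ = 1 := by
        rw [norm_smul, norm_inv, norm_norm, inv_mul_cancel₀ hx₀pos.ne']
      have hlamw : ∀ j, lam j (‖x₀‖⁻¹ • x₀) = ‖x₀‖⁻¹ * lam j x₀ := fun j => by rw [map_smul, smul_eq_mul]
      have hwS : ∀ j, lam j (‖x₀‖⁻¹ • x₀) ≠ 0 := fun j => by
        rw [hlamw]; exact mul_ne_zero (inv_ne_zero hx₀pos.ne') (hx₀.2 j)
      obtain ⟨a, ha, haw⟩ := exists_pos_le_abs lam (‖x₀‖⁻¹ • x₀) hwS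
      -- the chamber of `w = x₀/‖x₀‖` is the sign pattern `ε`
      have hcham : ∀ ξ ∈ puncturedBall lam (t / 2 ^ (n * r + 1)), (fun j => decide (0 < lam j ξ)) = ε →
          ∀ j, 0 < lam j ξ * lam j (‖x₀‖⁻¹ • x₀) := by
        intro ξ hξ hξε j
        have hiff : (0 < lam j ξ ↔ 0 < lam j x₀) := by
          have := congr_fun (hξε.trans hx₀ε.symm) j
          simpa using this
        rw [hlamw]
        have hinv : 0 < ‖x₀‖⁻¹ := inv_pos.2 hx₀pos
        rcases lt_or_gt_of_ne (hξ.2 j) with hneg | hpos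
        · have hx : lam j x₀ < 0 := lt_of_le_of_ne (not_lt.1 fun h => (not_lt.2 hneg.le) (hiff.2 h)) (hx₀.2 j)
          have : 0 < lam j ξ * lam j x₀ := mul_pos_of_neg_of_neg hneg hx
          nlinarith
        · have : 0 < lam j ξ * lam j x₀ := mul_pos hpos (hiff.1 hpos)
          nlinarith
      -- run the descent in this chamber
      have hb := base_case lam t φ ht j₀ (‖x₀‖⁻¹ • x₀) r hr
      have hd := descent lam t φ ht hφ j₀ (‖x₀‖⁻¹ • x₀) hw1 a ha haw (n * r) hb (n * r) le_rfl
      have hd' : ∀ (k : ℕ) (v : Fin k → EuclideanSpace ℝ (Fin m)), ∃ C : ℝ, ∀ ξ : EuclideanSpace ℝ (Fin m),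
          ‖ξ‖ ≤ t / 2 ^ (n * r) → (∀ j, 0 < lam j ξ * lam j (‖x₀‖⁻¹ • x₀)) → ∀ c : ℝ, 0 < c →
            (∀ j, c ≤ |lam j ξ|) →
              ‖iteratedFDerivWithin ℝ k φ (puncturedBall lam t) ξ v‖ ≤ C * c ^ (-(1 / 2 : ℝ)) := by
        intro k v
        obtain ⟨C, hC⟩ := hd k v
        refine ⟨C, fun ξ hξ hξw c hc hcξ => ?_⟩
        have := hC ξ hξ hξw c hc hcξ
        simpa using this
      obtain ⟨C, hC⟩ := step_final lam t φ ht hφ j₀ (‖x₀‖⁻¹ • x₀) hw1 a ha haw (t / 2 ^ (n * r))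
        (by positivity) (div_le_self ht.le (one_le_pow₀ (by norm_num))) hd' k v
      refine ⟨max C 0, le_max_right _ _, fun ξ hξ hξε => (hC ξ ?_ (hcham ξ hξ hξε)).trans (le_max_left _ _)⟩
      have : t / 2 ^ (n * r + 1) = t / 2 ^ (n * r) / 2 := by rw [pow_succ]; ring
      rw [← this]; exact hξ.1
    · exact ⟨0, le_rfl, fun ξ hξ hξε => absurd ⟨ξ, ⟨hξ.1.trans ht', hξ.2⟩, hξε⟩ hε⟩
  choose Cf hCf0 hCf using key
  refine ⟨∑ ε, Cf ε, fun ξ hξ => ?_⟩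
  calc ‖iteratedFDerivWithin ℝ k φ (puncturedBall lam t) ξ v‖ ≤ Cf (fun j => decide (0 < lam j ξ)) :=
        hCf _ ξ hξ rfl
    _ ≤ ∑ ε, Cf ε := Finset.single_le_sum (fun ε _ => hCf0 ε) (Finset.mem_univ _)

end Literature.NumberTheory.Rogawski1990.Ch9Sec3

end
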